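import Summits.BirchSwinnertonDyer.BirchSwinnertonDyer.Theses.ThetaPartnerAtTwo
import Literature.NumberTheory.EllipticCurves.IwasawaAlgebraDivisibilityProofs
import Literature.NumberTheory.EllipticCurves.SkinnerUrban2014.CharacteristicIdealBaseChangeProofs
import Literature.NumberTheory.EllipticCurves.Kato2004.MainConjectureSkeletonProofs
import Literature.NumberTheory.EllipticCurves.Kobayashi2003.SignedSelmerModuleFiniteProofs
import Literature.NumberTheory.EllipticCurves.PAdicLFunctionProofs
import Literature.NumberTheory.EllipticCurves.ModularFormsGamma0Genus
import Literature.NumberTheory.EllipticCurves.PAdicBSD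
import Summits.BirchSwinnertonDyer.BirchSwinnertonDyer.Theorems.UniversalToricDescentCharIdealVacuity
import HarnessLib

/-!
# Route `ThetaPartnerAtTwo` (TP2), crux K3 `SignedKatoDivisibilityUpToAtTwo` (item stmt-BirchSwinnertonDyer-20308):
# K3 is EXACTLY «Kato's divisibility of `char X⁺(E/ℚ_∞)` by `L♭` at every height-one prime of `Λ = ℤ₂⟦T⟧`
# OTHER THAN `(2)`» — a lossless, PUB-free reformulation in local lengths (lead `bsd-wall-tp2-p2x`, line
# `colemanrat` v2)

HONEST FRAMING (cell `bsd-wall`, run/shared/lean/pub/bsd-wall/): THEOREMS ONLY — no definition, no named fact,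
no instance, no `sorry`; nothing about any Selmer group is asserted beyond the displayed binders; closes no item
by itself; BSD is NOT proved by any of this.

## What is proved

* §1 (commutative algebra, any Noetherian UFD `R`, prime element `π₀`, `G ≠ 0`, `X` finitely generated
  torsion): `(∃ m, π₀^m · G ∈ char X) ↔ ∀ height-one 𝔭 ∌ π₀, ℓ_𝔭(X) ≤ ℓ_𝔭(R/(G))`
  (`exists_pow_mul_mem_charIdeal_iff_lengthAt_le`). The `←` half is the tree's
  `Module.exists_pow_mul_mem_charIdeal_of_lengthAt_le`; the `→` half is new (a divisor of `π₀^m G` has, off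
  `π₀`, at most the local lengths of `R/(G)`).
* §2 (any prime `p`, any sign `ε`, any dual datum `D` of `Sel^ε(E/K_∞)`): the K3-SHAPED conclusion
  `∃ g h m, char X^ε = (g) ∧ ι(g·h) = C(p^m·ϖ)·ι L` (period ratio `ϖ ∈ ℚˣ`, `L ∈ Λ ∖ 0`) is EQUIVALENT to
  `X^ε torsion → ∀ height-one 𝔭 ∌ p, ℓ_𝔭(X^ε) ≤ ℓ_𝔭(Λ/(L))` (`katoUpTo_iff_lengthAt_le_off_p`): the period
  ratio and the `p`-power are invisible off `p`, and off torsion both sides are trivially true (`char = ⊤`).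
* §3 K3 BY NAME ⟺ its local form (`signedKatoDivisibilityUpToAtTwo_iff_offTwo`, and the two directions
  `…_of_offTwo` / `offTwo_of_…`): on the theta habitat, for every cyclotomic datum, newform, period ratio,
  Pollack pair at `2` and dual datum `D` of `Sel⁺(E/ℚ_∞)`,
  `X⁺ torsion → ∀ height-one 𝔭 ∌ 2, ℓ_𝔭(X⁺(E/ℚ_∞)) ≤ ℓ_𝔭(Λ/(L♭))` (`L♭ = kobayashiL 1 L♯ L♭`).
  So K3 = Kobayashi's Thm. 1.3 (i) «`char X⁺ ⊇ (L⁺)` in `Λ ⊗ ℚ_p`» at `p = 2`, i.e. Kato's one-sided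
  divisibility (Thm. 12.5 (3) / 17.4 (2): the height-one primes NOT containing `p`) through the `+` Coleman
  map, and NOTHING at `𝔭 = (2)`; the two Kato PUB facts of the line's former stub `stub_katoPubTwo`
  (`Kato2004.thm12_4`, `Kato2004_fineSelmerDual_isTorsion`) are NOT needed for this equivalence.

References: [Kobayashi2003] Thm. 1.3 (i) (p. 2), Thm. 4.1 (p. 8), Thm. 7.3–7.4 (p. 13); [Kato2004Asterisque]
Thm. 12.5 (3) (p. 222), Thm. 13.4 (2) (p. 226), Thm. 17.4 (2) (p. 273); [Washington1997] §13.2.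
-/

set_option autoImplicit false
-- the Theorems namespace of this sub repeats the summit name by design (D-0017 nested layout)
set_option linter.dupNamespace false

noncomputable section

open scoped Classical MatrixGroups ModularForm

open CongruenceSubgroup WeierstrassCurve Literature.NumberTheory.EllipticCurves
  Literature.NumberTheory.EllipticCurves.ModularForms Literature.NumberTheory.EllipticCurves.Module
  Literature.NumberTheory.EllipticCurves.Rank1Residual
  Literature.NumberTheory.EllipticCurves.Kobayashi2003 ZpExtension
  Summit.BirchSwinnertonDyer.Rank1Residual.Supersingular
  Summit.BirchSwinnertonDyer.BirchSwinnertonDyer.Theses.ThetaPartnerAtTwo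

namespace Summit.BirchSwinnertonDyer.BirchSwinnertonDyer.Theorems

namespace SignedKatoOffTwo

/-! ## §1 Commutative algebra: `π₀^m G ∈ char X` versus local lengths off `π₀` -/

section Algebra

variable {R : Type*} [CommRing R] [IsDomain R] [IsNoetherianRing R] [UniqueFactorizationMonoid R]
  {X : Type*} [AddCommGroup X] [_root_.Module R X]

omit [IsNoetherianRing R] [UniqueFactorizationMonoid R] in
/-- `R/(a)` is a torsion `R`-module for `a ≠ 0` (killed by `a`). [folklore] -/
private theorem isTorsion_quotient_span_singleton {a : R} (ha : a ≠ 0) :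
    Module.IsTorsion R (R ⧸ Ideal.span {a}) := by
  have hby : Module.IsTorsionBy R (R ⧸ Ideal.span {a}) a :=
    (Module.isTorsionBy_quotient_iff _ a).mpr fun y ↦ by
      rw [smul_eq_mul]
      exact Ideal.mul_mem_right y _ (Ideal.mem_span_singleton_self a)
  exact fun x ↦ ⟨⟨a, mem_nonZeroDivisors_of_ne_zero ha⟩, @hby x⟩

omit [IsNoetherianRing R] [UniqueFactorizationMonoid R] in
/-- Off a prime element `π₀`, the cyclic module `R/(π₀^m · G)` has the same local lengths as `R/(G)`:
`ℓ_𝔭(R/(π₀^m G)) = ℓ_𝔭(R/(G))` at every prime `𝔭 ∌ π₀`. [folklore] -/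
theorem lengthAt_quotient_span_pow_mul_eq_of_not_mem {π₀ : R} (hπ₀ : Prime π₀) (m : ℕ) (G : R)
    (𝔭 : PrimeSpectrum R) (h𝔭 : π₀ ∉ 𝔭.asIdeal) :
    lengthAt R (R ⧸ Ideal.span {π₀ ^ m * G}) 𝔭 = lengthAt R (R ⧸ Ideal.span {G}) 𝔭 := by
  rw [lengthAt_quotient_span_singleton_mul G (pow_ne_zero m hπ₀.ne_zero) 𝔭,
    lengthAt_quotient_eq_zero_of_not_le (I := Ideal.span {π₀ ^ m}) ?_, zero_add]
  rw [Ideal.span_singleton_le_iff_mem]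
  exact fun h ↦ h𝔭 (𝔭.isPrime.mem_of_pow_mem m h)

/-- **`π₀^m · G ∈ char(X)` for some `m` ⟺ `ℓ_𝔭(X) ≤ ℓ_𝔭(R/(G))` at every height-one prime `𝔭 ∌ π₀`**
(`R` a Noetherian UFD, `X` finitely generated torsion, `π₀` a prime element, `G ≠ 0`). `←` is the tree's
`Module.exists_pow_mul_mem_charIdeal_of_lengthAt_le` (Washington §13.2: `char X = ∏ 𝔭^{ℓ_𝔭(X)}`); `→`:
`(π₀^m G) = char(R/(π₀^m G)) ⊆ char X` bounds `ℓ_𝔭(X)` by `ℓ_𝔭(R/(π₀^m G)) = ℓ_𝔭(R/(G))` off `π₀`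
(`SkinnerUrban2014.lengthAt_le_of_charIdeal_le`). Over `Λ = ℤ_p⟦T⟧` with `π₀ = p` this is the passage
between Kato's printed LENGTH form of Thm. 17.4 (2) and the divisibility «`char X ∣ p^m G`», now in both
directions. [cite: Washington1997, §13.2] [cite: Kato2004Asterisque, Thm. 17.4 (2) (p. 273)] -/
theorem exists_pow_mul_mem_charIdeal_iff_lengthAt_le [Module.Finite R X] (hX : Module.IsTorsion R X)
    {π₀ : R} (hπ₀ : Prime π₀) {G : R} (hG : G ≠ 0) :
    (∃ m : ℕ, π₀ ^ m * G ∈ charIdeal R X) ↔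
      ∀ 𝔭 : PrimeSpectrum R, 𝔭.asIdeal.height = 1 → π₀ ∉ 𝔭.asIdeal →
        lengthAt R X 𝔭 ≤ lengthAt R (R ⧸ Ideal.span {G}) 𝔭 := by
  refine ⟨fun ⟨m, hm⟩ 𝔭 h𝔭 hπ𝔭 ↦ ?_, exists_pow_mul_mem_charIdeal_of_lengthAt_le hX hπ₀ hG⟩
  have hne : π₀ ^ m * G ≠ 0 := mul_ne_zero (pow_ne_zero m hπ₀.ne_zero) hG
  have hQ := isTorsion_quotient_span_singleton (R := R) hne
  have hcharQ : charIdeal R (R ⧸ Ideal.span {π₀ ^ m * G}) = Ideal.span {π₀ ^ m * G} :=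
    charIdeal_eq_span_of_lengthAt_eq_quotient hne fun _ _ ↦ rfl
  have hle : charIdeal R (R ⧸ Ideal.span {π₀ ^ m * G}) ≤ charIdeal R X := by
    rw [hcharQ, Ideal.span_singleton_le_iff_mem]
    exact hm
  rw [← lengthAt_quotient_span_pow_mul_eq_of_not_mem hπ₀ m G 𝔭 hπ𝔭]
  exact SkinnerUrban2014.lengthAt_le_of_charIdeal_le hQ hX hle 𝔭 h𝔭

end Algebra

/-! ## §2 The K3-shaped conclusion versus local lengths off `p` (any `p`, any sign, any dual datum) -/

section AnyPrime

variable {p : ℕ} [Fact p.Prime] {K : Type} [Field K] [NumberField K] {W : WeierstrassCurve K} [W.IsElliptic]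
  {κ : ZpExtension K p} {γ : Field.absoluteGaloisGroup K} {ε : ℤˣ}

/-- A non-zero integer is a unit times a power of `p` in `ℤ_p`. [folklore] -/
private theorem exists_unit_mul_pow_eq_intCast {n : ℤ} (hn : n ≠ 0) :
    ∃ (u : ℤ_[p]ˣ) (b : ℕ), (n : ℤ_[p]) = (u : ℤ_[p]) * (p : ℤ_[p]) ^ b := by
  have hn' : (n : ℤ_[p]) ≠ 0 := Int.cast_ne_zero.mpr hn
  exact ⟨PadicInt.unitCoeff hn', (n : ℤ_[p]).valuation, PadicInt.unitCoeff_spec hn'⟩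

/-- `ι(C c · x) = C c · ι x` for `c ∈ ℤ_p` (coefficientwise inclusion). [folklore] -/
private theorem iota_C_mul (c : ℤ_[p]) (x : IwasawaAlgebra p) :
    iwasawaToPowerSeries p (PowerSeries.C c * x) =
      PowerSeries.C (c : ℚ_[p]) * iwasawaToPowerSeries p x := by
  rw [map_mul, PowerSeries.map_C]; rfl

/-- `ι(C c ^ m · x) = C (c ^ m) · ι x` for `c ∈ ℤ_p`. [folklore] -/
private theorem iota_C_pow_mul (c : ℤ_[p]) (m : ℕ) (x : IwasawaAlgebra p) :
    iwasawaToPowerSeries p (PowerSeries.C c ^ m * x) =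
      PowerSeries.C ((c : ℚ_[p]) ^ m) * iwasawaToPowerSeries p x := by
  rw [← map_pow, iota_C_mul, PadicInt.coe_pow]

/-- **K3's conclusion shape ⟺ Kato's divisibility in local lengths off `p`.** For a dual datum `D` of
`Sel^ε(E/K_∞)` (its `X^ε` is finitely generated over `Λ`: tree theorem `SignedSelmerDualData.moduleFinite`),
a non-zero `L ∈ Λ` and a non-zero period ratio `ϖ ∈ ℚ`:
`(∃ g h m, char X^ε = (g) ∧ ι(g·h) = C(p^m·ϖ)·ι L) ↔ (X^ε torsion → ∀ height-one 𝔭 ∌ p, ℓ_𝔭(X^ε) ≤ ℓ_𝔭(Λ/(L)))`.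
Proof: off torsion `char X^ε = ⊤` (junk) and both sides hold; on torsion, clearing the denominator of `ϖ`
(`ϖ = n/d`, `d = u'·p^c` in `ℤ_p`) turns the left side into `∃ m, p^m·(C(n)·L) ∈ char X^ε`
(`char` is principal: `charIdeal_isPrincipal_holds`; `ι` is injective), which is §1 with `π₀ = C(p)`, and
`ℓ_𝔭(Λ/(C(n)·L)) = ℓ_𝔭(Λ/(L))` off `p` (`n = u·p^b`).
[cite: Kobayashi2003, Thm. 1.3 (i) (p. 2) and Thm. 4.1 (p. 8)] [cite: Kato2004Asterisque, Thm. 17.4 (2) (p. 273)]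
[cite: Washington1997, §13.2] -/
theorem katoUpTo_iff_lengthAt_le_off_p (hγ : κ.IsTopGenerator γ) (D : SignedSelmerDualData W κ γ ε)
    {L : IwasawaAlgebra p} (hL : L ≠ 0) {ϖ : ℚ} (hϖ : ϖ ≠ 0) :
    (∃ (g h : IwasawaAlgebra p) (m : ℕ), D.charIdeal = Ideal.span {g} ∧
      iwasawaToPowerSeries p (g * h) =
        PowerSeries.C ((p : ℚ_[p]) ^ m * (ϖ : ℚ_[p])) * iwasawaToPowerSeries p L) ↔
    (Module.IsTorsion (IwasawaAlgebra p) D.X →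
      ∀ 𝔭 : PrimeSpectrum (IwasawaAlgebra p), 𝔭.asIdeal.height = 1 →
        PowerSeries.C (p : ℤ_[p]) ∉ 𝔭.asIdeal →
        lengthAt (IwasawaAlgebra p) D.X 𝔭 ≤
          lengthAt (IwasawaAlgebra p) (IwasawaAlgebra p ⧸ Ideal.span {L}) 𝔭) := by
  haveI : Module.Finite (IwasawaAlgebra p) D.X := D.moduleFinite hγ
  have hpP : Prime (PowerSeries.C (p : ℤ_[p]) : IwasawaAlgebra p) := IwasawaAlgebra.prime_C p
  -- `ϖ = n / d`; in `ℤ_p`: `n = u · p^b`, `d = u' · p^c`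
  set n : ℤ := ϖ.num with hndef
  set d : ℤ := (ϖ.den : ℤ) with hddef
  have hn : n ≠ 0 := Rat.num_ne_zero.mpr hϖ
  have hd : d ≠ 0 := Int.natCast_ne_zero.mpr ϖ.den_nz
  obtain ⟨u, b, hu⟩ := exists_unit_mul_pow_eq_intCast (p := p) hn
  obtain ⟨u', c, hu'⟩ := exists_unit_mul_pow_eq_intCast (p := p) hd
  -- scalar identities in `ℚ_p`
  have hϖnd : (ϖ : ℚ_[p]) * ((d : ℤ_[p]) : ℚ_[p]) = ((n : ℤ_[p]) : ℚ_[p]) := by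
    rw [PadicInt.coe_intCast, PadicInt.coe_intCast, hndef, hddef]
    have h := Rat.mul_den_eq_num ϖ
    exact_mod_cast congrArg (fun q : ℚ ↦ (q : ℚ_[p])) h
  have huu : ((u' : ℤ_[p]) : ℚ_[p]) * (((u'⁻¹ : ℤ_[p]ˣ) : ℤ_[p]) : ℚ_[p]) = 1 := by
    rw [← PadicInt.coe_mul, Units.mul_inv, PadicInt.coe_one]
  have hd' : ((d : ℤ_[p]) : ℚ_[p]) = ((u' : ℤ_[p]) : ℚ_[p]) * (p : ℚ_[p]) ^ c := by
    rw [hu', PadicInt.coe_mul, PadicInt.coe_pow, PadicInt.coe_natCast]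
  have S0 : ((n : ℤ_[p]) : ℚ_[p]) * (((u'⁻¹ : ℤ_[p]ˣ) : ℤ_[p]) : ℚ_[p]) =
      (p : ℚ_[p]) ^ c * (ϖ : ℚ_[p]) := by
    rw [← hϖnd, hd']
    linear_combination ((ϖ : ℚ_[p]) * (p : ℚ_[p]) ^ c) * huu
  -- the integral avatar `G = C(n) · L` of `ϖ · L`
  set G : IwasawaAlgebra p := PowerSeries.C (n : ℤ_[p]) * L with hGdef
  have hCn : (PowerSeries.C (n : ℤ_[p]) : IwasawaAlgebra p) ≠ 0 := fun h ↦
    (Int.cast_ne_zero.mpr hn : (n : ℤ_[p]) ≠ 0) (PowerSeries.C_injective (h.trans (map_zero _).symm))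
  have hG : G ≠ 0 := mul_ne_zero hCn hL
  -- local lengths of `Λ/(G)` and `Λ/(L)` agree off `p`
  have hlenG : ∀ 𝔭 : PrimeSpectrum (IwasawaAlgebra p), PowerSeries.C (p : ℤ_[p]) ∉ 𝔭.asIdeal →
      lengthAt (IwasawaAlgebra p) (IwasawaAlgebra p ⧸ Ideal.span {G}) 𝔭 =
        lengthAt (IwasawaAlgebra p) (IwasawaAlgebra p ⧸ Ideal.span {L}) 𝔭 := by
    intro 𝔭 hp𝔭
    have hGeq : G = PowerSeries.C (p : ℤ_[p]) ^ b * (PowerSeries.C (u : ℤ_[p]) * L) := by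
      rw [hGdef, hu, map_mul, map_pow, map_natCast]
      ring
    rw [hGeq, lengthAt_quotient_span_pow_mul_eq_of_not_mem hpP b _ 𝔭 hp𝔭]
    have hunit : IsUnit (PowerSeries.C (u : ℤ_[p]) : IwasawaAlgebra p) :=
      (Units.isUnit u).map PowerSeries.C
    rw [Ideal.span_singleton_mul_left_unit hunit]
  constructor
  · -- `→`
    rintro ⟨g, h, m, hg, hgh⟩ hX 𝔭 h𝔭 hp𝔭
    rw [← hlenG 𝔭 hp𝔭]
    refine (exists_pow_mul_mem_charIdeal_iff_lengthAt_le hX hpP hG).mp ⟨m, ?_⟩ 𝔭 h𝔭 hp𝔭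
    -- `ι(C(p)^m · G) = ι(g · (h · C d))`, so `C(p)^m · G = g · (h · C d) ∈ (g) = char X`
    have key : iwasawaToPowerSeries p (PowerSeries.C (p : ℤ_[p]) ^ m * G) =
        iwasawaToPowerSeries p (g * (h * PowerSeries.C (d : ℤ_[p]))) := by
      rw [iota_C_pow_mul, hGdef, iota_C_mul, ← mul_assoc g h, mul_comm (g * h), iota_C_mul, hgh,
        PadicInt.coe_natCast, ← mul_assoc, ← mul_assoc, ← map_mul, ← map_mul]
      congr 2
      linear_combination ((p : ℚ_[p]) ^ m) * hϖnd.symm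
    have hmem : PowerSeries.C (p : ℤ_[p]) ^ m * G ∈ Ideal.span {g} :=
      Ideal.mem_span_singleton'.mpr ⟨h * PowerSeries.C (d : ℤ_[p]),
        by rw [mul_comm, iwasawaToPowerSeries_injective p key]⟩
    change _ ∈ D.charIdeal
    rw [hg]
    exact hmem
  · -- `←`
    intro hloc
    by_cases hX : Module.IsTorsion (IwasawaAlgebra p) D.X
    · obtain ⟨g, hg⟩ := (charIdeal_isPrincipal_holds p D.X).principal
      have hg' : D.charIdeal = Ideal.span {g} := hg
      obtain ⟨m, hm⟩ := (exists_pow_mul_mem_charIdeal_iff_lengthAt_le hX hpP hG).mpr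
        fun 𝔭 h𝔭 hp𝔭 ↦ (hloc hX 𝔭 h𝔭 hp𝔭).trans (hlenG 𝔭 hp𝔭).ge
      have hm' : PowerSeries.C (p : ℤ_[p]) ^ m * G ∈ Ideal.span {g} := by
        rw [← hg']; exact hm
      obtain ⟨h₀, hh₀⟩ := Ideal.mem_span_singleton'.mp hm'
      -- `ι(g · (h₀ · C(u'⁻¹))) = C(p^(m+c) ϖ) · ι L`
      refine ⟨g, h₀ * PowerSeries.C ((u'⁻¹ : ℤ_[p]ˣ) : ℤ_[p]), m + c, hg', ?_⟩
      rw [← mul_assoc, mul_comm g h₀, hh₀, mul_comm _ (PowerSeries.C _), iota_C_mul,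
        iota_C_pow_mul, hGdef, iota_C_mul, PadicInt.coe_natCast, ← mul_assoc, ← mul_assoc, ← map_mul,
        ← map_mul]
      congr 2
      rw [pow_add]
      linear_combination ((p : ℚ_[p]) ^ m) * S0
    · -- off torsion: `char X = ⊤`; take `g = 1`, `h = C(n · u'⁻¹) · L`, `m = c`
      have htop : D.charIdeal = ⊤ :=
        UniversalToricDescentCharIdealVacuity.charIdeal_eq_top_of_not_isTorsion hX
      refine ⟨1, PowerSeries.C ((n : ℤ_[p]) * ((u'⁻¹ : ℤ_[p]ˣ) : ℤ_[p])) * L, c, ?_, ?_⟩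
      · rw [htop, Ideal.span_singleton_one]
      · rw [one_mul, iota_C_mul, PadicInt.coe_mul, S0]

end AnyPrime

/-! ## §3 K3 BY NAME ⟺ Kato's divisibility off `2` in local lengths -/

section AtTwo

/-- The period ratio of a newform frame is non-zero: `ϖ · Ω_E = Ω⁺_f > 0` (tree theorem
`IsNewform0.plusPeriod_pos_holds`). [cite: Kobayashi2003, (3.4)–(3.6) (p. 7)] -/
theorem varpi_ne_zero {W : WeierstrassCurve ℚ} [W.IsElliptic] {N : ℕ} [NeZero N]
    {f : CuspForm (Gamma0 N) 2} (hf : IsNewformOf W f) {ϖ : ℚ}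
    (hϖ : (ϖ : ℝ) * W.realPeriodRat = plusPeriod f) : ϖ ≠ 0 := by
  rintro rfl
  rw [Rat.cast_zero, zero_mul] at hϖ
  exact (IsNewform0.plusPeriod_pos_holds hf.1 hf.coeffField_eq_bot).ne hϖ

/-- **K3 `SignedKatoDivisibilityUpToAtTwo` ⟺ its LOCAL form off `2`** (lossless, PUB-free): on the theta
habitat (`E` non-CM, `r_an = 0`, good supersingular at `2`, `a₂ = 0`), for every cyclotomic datum matching
the variable, newform `f`, period ratio `ϖ`, Pollack pair `(L♯, L♭)` at `2` and dual datum `D` of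
`Sel⁺(E/ℚ_∞)`: K3's conclusion `∃ g h m, char X⁺ = (g) ∧ ι(g·h) = C(2^m·ϖ)·ι L♭` holds for all such data
iff, for all such data, `X⁺ torsion → ∀ height-one 𝔭 ∌ 2, ℓ_𝔭(X⁺(E/ℚ_∞)) ≤ ℓ_𝔭(Λ/(L♭))`
(`L♭ = kobayashiL 1 L♯ L♭ ≠ 0` by `IsPollackPair`, `ϖ ≠ 0` by `varpi_ne_zero`; then §2 datum by datum).
READING: K3 is Kobayashi's Thm. 1.3 (i) «`char X⁺ ⊇ (L_p⁺)` in `Λ ⊗ ℚ_p`» at `p = 2` — Kato's divisibility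
at the height-one primes NOT containing `2` (Thm. 12.5 (3) / 13.4 (2) / 17.4 (2) carry no hypothesis there)
— and says NOTHING at `𝔭 = (2)` (no `μ`-statement, no period unit, no image hypothesis).
[cite: Kobayashi2003, Thm. 1.3 (i) (p. 2), Thm. 4.1 (p. 8)] [cite: Kato2004Asterisque, Thm. 12.5 (3) (p. 222), Thm. 17.4 (2) (p. 273)] -/
theorem signedKatoDivisibilityUpToAtTwo_iff_offTwo :
    SignedKatoDivisibilityUpToAtTwo ↔
    ∀ (W : WeierstrassCurve ℚ) [W.IsElliptic] [W.IsGloballyMinimal],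
      ¬ W.HasCM → W.analyticRank = 0 → GoodSS W 2 → W.frobeniusTrace 2 = 0 →
      ∀ (κ : ZpExtension ℚ 2) (γ : Field.absoluteGaloisGroup ℚ),
        κ.IsCyclotomic → κ.IsTopGenerator γ → IsCyclotomicVariable 2 γ →
        ∀ [NeZero (W.conductorNorm ℤ)] (f : CuspForm (Gamma0 (W.conductorNorm ℤ)) 2),
          IsNewformOf W f → ∀ (ϖ : ℚ), (ϖ : ℝ) * W.realPeriodRat = plusPeriod f →
        ∀ (Lplus Lminus : IwasawaAlgebra 2), IsPollackPair f 2 Lplus Lminus →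
        ∀ (D : SignedSelmerDualData W κ γ 1), Module.IsTorsion (IwasawaAlgebra 2) D.X →
          ∀ 𝔭 : PrimeSpectrum (IwasawaAlgebra 2), 𝔭.asIdeal.height = 1 →
            PowerSeries.C (2 : ℤ_[2]) ∉ 𝔭.asIdeal →
            lengthAt (IwasawaAlgebra 2) D.X 𝔭 ≤
              lengthAt (IwasawaAlgebra 2) (IwasawaAlgebra 2 ⧸ Ideal.span {kobayashiL 1 Lplus Lminus}) 𝔭 := by
  constructor
  · intro h W _ _ hcm hr hss ha κ γ hκ hγ hcv _ f hf ϖ hϖ Lplus Lminus hPP D hX 𝔭 h𝔭 hp𝔭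
    have hL : kobayashiL 1 Lplus Lminus ≠ 0 := by
      rw [kobayashiL, if_pos rfl]; exact hPP.2.1
    have h3 := h W hcm hr hss ha κ γ hκ hγ hcv f hf ϖ hϖ Lplus Lminus hPP D
    have h3' : ∃ (g h : IwasawaAlgebra 2) (m : ℕ), D.charIdeal = Ideal.span {g} ∧
        iwasawaToPowerSeries 2 (g * h) =
          PowerSeries.C ((((2 : ℕ) : ℕ) : ℚ_[2]) ^ m * (ϖ : ℚ_[2])) *
            iwasawaToPowerSeries 2 (kobayashiL 1 Lplus Lminus) := by
      simpa only [Nat.cast_ofNat] using h3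
    have hp2 : PowerSeries.C ((2 : ℕ) : ℤ_[2]) ∉ 𝔭.asIdeal := by simpa only [Nat.cast_ofNat] using hp𝔭
    exact (katoUpTo_iff_lengthAt_le_off_p (p := 2) hγ D hL (varpi_ne_zero hf hϖ)).mp h3' hX 𝔭 h𝔭 hp2
  · intro h W _ _ hcm hr hss ha κ γ hκ hγ hcv _ f hf ϖ hϖ Lplus Lminus hPP D
    have hL : kobayashiL 1 Lplus Lminus ≠ 0 := by
      rw [kobayashiL, if_pos rfl]; exact hPP.2.1
    have hloc : Module.IsTorsion (IwasawaAlgebra 2) D.X →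
        ∀ 𝔭 : PrimeSpectrum (IwasawaAlgebra 2), 𝔭.asIdeal.height = 1 →
          PowerSeries.C ((2 : ℕ) : ℤ_[2]) ∉ 𝔭.asIdeal →
          lengthAt (IwasawaAlgebra 2) D.X 𝔭 ≤
            lengthAt (IwasawaAlgebra 2) (IwasawaAlgebra 2 ⧸ Ideal.span {kobayashiL 1 Lplus Lminus}) 𝔭 :=
      fun hX 𝔭 h𝔭 hp𝔭 ↦ h W hcm hr hss ha κ γ hκ hγ hcv f hf ϖ hϖ Lplus Lminus hPP D hX 𝔭 h𝔭
        (by simpa only [Nat.cast_ofNat] using hp𝔭)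
    have h3 := (katoUpTo_iff_lengthAt_le_off_p (p := 2) hγ D hL (varpi_ne_zero hf hϖ)).mpr hloc
    simpa only [Nat.cast_ofNat] using h3

/-- **K3 FROM its local form off `2`** (the direction the line's composition uses; closes K3 once the
registered stub `stub_offTwo` of line `colemanrat` v2 lands). [cite: Kobayashi2003, Thm. 1.3 (i) (p. 2)]
[cite: Kato2004Asterisque, Thm. 17.4 (2) (p. 273)] -/
theorem signedKatoDivisibilityUpToAtTwo_of_offTwo
    (h : ∀ (W : WeierstrassCurve ℚ) [W.IsElliptic] [W.IsGloballyMinimal],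
      ¬ W.HasCM → W.analyticRank = 0 → GoodSS W 2 → W.frobeniusTrace 2 = 0 →
      ∀ (κ : ZpExtension ℚ 2) (γ : Field.absoluteGaloisGroup ℚ),
        κ.IsCyclotomic → κ.IsTopGenerator γ → IsCyclotomicVariable 2 γ →
        ∀ [NeZero (W.conductorNorm ℤ)] (f : CuspForm (Gamma0 (W.conductorNorm ℤ)) 2),
          IsNewformOf W f → ∀ (ϖ : ℚ), (ϖ : ℝ) * W.realPeriodRat = plusPeriod f →
        ∀ (Lplus Lminus : IwasawaAlgebra 2), IsPollackPair f 2 Lplus Lminus →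
        ∀ (D : SignedSelmerDualData W κ γ 1), Module.IsTorsion (IwasawaAlgebra 2) D.X →
          ∀ 𝔭 : PrimeSpectrum (IwasawaAlgebra 2), 𝔭.asIdeal.height = 1 →
            PowerSeries.C (2 : ℤ_[2]) ∉ 𝔭.asIdeal →
            lengthAt (IwasawaAlgebra 2) D.X 𝔭 ≤
              lengthAt (IwasawaAlgebra 2) (IwasawaAlgebra 2 ⧸ Ideal.span {kobayashiL 1 Lplus Lminus}) 𝔭) :
    SignedKatoDivisibilityUpToAtTwo :=
  signedKatoDivisibilityUpToAtTwo_iff_offTwo.mpr h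

/-- **NECESSITY: K3 implies its local form off `2`** — the reshaped stub is LOSSLESS (a `stub-false`
witness for it refutes K3 itself). [cite: Kobayashi2003, Thm. 1.3 (i) (p. 2)]
[cite: Kato2004Asterisque, Thm. 17.4 (2) (p. 273)] -/
theorem offTwo_of_signedKatoDivisibilityUpToAtTwo (h : SignedKatoDivisibilityUpToAtTwo) :
    ∀ (W : WeierstrassCurve ℚ) [W.IsElliptic] [W.IsGloballyMinimal],
      ¬ W.HasCM → W.analyticRank = 0 → GoodSS W 2 → W.frobeniusTrace 2 = 0 →
      ∀ (κ : ZpExtension ℚ 2) (γ : Field.absoluteGaloisGroup ℚ),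
        κ.IsCyclotomic → κ.IsTopGenerator γ → IsCyclotomicVariable 2 γ →
        ∀ [NeZero (W.conductorNorm ℤ)] (f : CuspForm (Gamma0 (W.conductorNorm ℤ)) 2),
          IsNewformOf W f → ∀ (ϖ : ℚ), (ϖ : ℝ) * W.realPeriodRat = plusPeriod f →
        ∀ (Lplus Lminus : IwasawaAlgebra 2), IsPollackPair f 2 Lplus Lminus →
        ∀ (D : SignedSelmerDualData W κ γ 1), Module.IsTorsion (IwasawaAlgebra 2) D.X →
          ∀ 𝔭 : PrimeSpectrum (IwasawaAlgebra 2), 𝔭.asIdeal.height = 1 →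
            PowerSeries.C (2 : ℤ_[2]) ∉ 𝔭.asIdeal →
            lengthAt (IwasawaAlgebra 2) D.X 𝔭 ≤
              lengthAt (IwasawaAlgebra 2) (IwasawaAlgebra 2 ⧸ Ideal.span {kobayashiL 1 Lplus Lminus}) 𝔭 :=
  signedKatoDivisibilityUpToAtTwo_iff_offTwo.mp h

end AtTwo

end SignedKatoOffTwo

end Summit.BirchSwinnertonDyer.BirchSwinnertonDyer.Theorems

end
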